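import Literature.Analysis.ODE.CompactSupportFlow
import Literature.Topology.FourManifolds.ChartFieldFlow
import Mathlib.Analysis.Calculus.ContDiff.RCLike
import HarnessLib

/-!
# The flow of a cut-off homothety field: fixed points, exact contraction, invariant rays

Topic `Literature/Topology/FourManifolds` (trunk T-4MAN). Infrastructure for the fact seat
`provefact-Literature.Topology.FourManifolds.Knot.IsConnectedSum.isIsotopic` (Schubert's theorem:
in the proof of the geometric heart one summand of a band sum, together with everything attached
to it on its side of the separating sphere, is shrunk into a small ball by an ambient isotopy of
`𝕊³` — the flow of a *cut-off homothety field* read in a stereographic chart). Everything here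
is proved; no named facts are introduced.

Let `F` be a real Banach space, `o ∈ F` a centre and `χ : F → ℝ` a `C^∞` function with compact
support. The **cut-off homothety field** is `Literature.Topology.FourManifolds.cutoffField χ o y =
-χ(y) (y - o)`. It is `C^∞`, compactly supported, Lipschitz and bounded, so it has a global flow
`Literature.Topology.FourManifolds.cutoffFlow` (the tree's `Literature.Analysis.ODE.globalFlow`,
Lang (1995), IV §1), jointly `C^∞`, with the group law. Its three uses:

* **fixed points**: where `χ y = 0` (or `y = o`) the flow is stationary (`cutoffFlow_eq_self_of_eq_zero`);
* **exact contraction**: as long as `χ = 1` along the ray segment `o + e^{-s} (y - o)`, the flow is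
  the homothety `y ↦ o + e^{-s} (y - o)` (`cutoffFlow_eq_homothety`);
* **invariant rays**: every trajectory stays on its ray from `o`: `cutoffFlow y s =
  o + r s • (y - o)` for the solution `r` of the scalar equation `r' = -χ(o + r (y - o)) r`,
  `r 0 = 1` (`cutoffFlow_eq_ray`); when `0 ≤ χ ≤ 1`, `e^{-s} ≤ r s ≤ 1` for `s ≥ 0`
  (`rayFactor_le_one`, `exp_neg_le_rayFactor`, `cutoffFlow_mem_ray`): points move monotonically
  towards the centre, at most at unit exponential rate, and never reach it.

Transported to a closed manifold `N` along a full chart `Φ` (`ChartFieldFlow.lean`: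
`chartField`, `IsFullChart`), the flow of `chartField Φ (cutoffField χ o)` carries `Φ⁻¹ y` to
`Φ⁻¹ (cutoffFlow y s)` (`IsFullChart.flow_chartField_cutoff`) and fixes the points off the chart;
`IsFullChart.cutoffContraction` is the resulting ambient isotopy of `N` run up to time `T`
(`flowIsotopyAt`), with its end stage described by the three items above
(`cutoffContraction_one_symm`, `cutoffContraction_toFun_symm_of_eq_zero`,
`cutoffContraction_one_symm_eq_homothety`, `cutoffContraction_one_symm_mem_ray`); it is an ambient
isotopy from the identity (`isAmbientIsotopic_cutoffContraction`).

## References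

* S. Lang, *Differential and Riemannian Manifolds*, GTM 160 (1995), Ch. IV §1. [Lang1995]
* M. W. Hirsch, *Differential Topology*, GTM 33 (1976), Ch. 8 §1, Thms. 1.1–1.2 (compactly
  supported vector fields generate diffeotopies). [HirschDT1976]
* J. M. Lee, *Introduction to Smooth Manifolds*, 2nd ed. (2012), Prop. 9.6, Thm. 9.12.
  [LeeSmoothManifolds2013]
-/

open scoped Manifold ContDiff Topology NNReal
open Set Function Filter Metric

noncomputable section

namespace Literature.Topology.FourManifolds

/-! ## The cut-off homothety field and its global flow -/

section Field

variable {F : Type*} [NormedAddCommGroup F] [NormedSpace ℝ F]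

/-- **The cut-off homothety field** `y ↦ -χ(y) (y - o)` with centre `o` and cut-off `χ`.
[folklore] -/
def cutoffField (χ : F → ℝ) (o : F) (y : F) : F := -(χ y • (y - o))

/-- Value of the cut-off homothety field. [folklore] -/
theorem cutoffField_apply (χ : F → ℝ) (o y : F) : cutoffField χ o y = -(χ y • (y - o)) := rfl

variable {χ : F → ℝ} {o : F}

/-- Where the cut-off is `1` the field is the homothety field `-(y - o)`. [folklore] -/
theorem cutoffField_of_eq_one {y : F} (hy : χ y = 1) : cutoffField χ o y = -(y - o) := by
  rw [cutoffField_apply, hy, one_smul]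

/-- Where the cut-off vanishes the field vanishes. [folklore] -/
theorem cutoffField_of_eq_zero {y : F} (hy : χ y = 0) : cutoffField χ o y = 0 := by
  rw [cutoffField_apply, hy, zero_smul, neg_zero]

/-- The field vanishes at the centre. [folklore] -/
@[simp] theorem cutoffField_centre : cutoffField χ o o = 0 := by
  simp [cutoffField_apply]

/-- The cut-off homothety field is `C^∞` for a `C^∞` cut-off. [folklore] -/
theorem contDiff_cutoffField (hχ : ContDiff ℝ ∞ χ) : ContDiff ℝ ∞ (cutoffField χ o) :=
  (hχ.smul (contDiff_id.sub contDiff_const)).neg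

/-- The cut-off homothety field has compact support when the cut-off has. [folklore] -/
theorem hasCompactSupport_cutoffField (hχc : HasCompactSupport χ) : HasCompactSupport (cutoffField χ o) := by
  have e : cutoffField χ o = -(χ • fun y : F ↦ y - o) := by
    funext y; rfl
  rw [e]
  exact hχc.smul_right.neg

/-- A compactly supported `C^∞` cut-off gives a Lipschitz and bounded field. [folklore] -/
theorem exists_lipschitzWith_cutoffField (hχ : ContDiff ℝ ∞ χ) (hχc : HasCompactSupport χ) :
    ∃ KL : ℝ≥0 × ℝ, LipschitzWith KL.1 (cutoffField χ o) ∧ ∀ y, ‖cutoffField χ o y‖ ≤ KL.2 := by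
  obtain ⟨C, hC⟩ := (contDiff_cutoffField (o := o) hχ).lipschitzWith_of_hasCompactSupport
    (hasCompactSupport_cutoffField hχc) (by simp)
  obtain ⟨B, hB⟩ := (hasCompactSupport_cutoffField (o := o) hχc).exists_bound_of_continuous
    (contDiff_cutoffField hχ).continuous
  exact ⟨(C, B), hC, hB⟩

variable [CompleteSpace F]

/-- **The global flow of the cut-off homothety field** (`Literature.Analysis.ODE.globalFlow`).
[cite: Lang1995, Ch. IV §1, Thm. 1.16] -/
def cutoffFlow (hχ : ContDiff ℝ ∞ χ) (hχc : HasCompactSupport χ) (o : F) : F → ℝ → F :=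
  Literature.Analysis.ODE.globalFlow (exists_lipschitzWith_cutoffField (o := o) hχ hχc).choose_spec.1
    (exists_lipschitzWith_cutoffField (o := o) hχ hχc).choose_spec.2

/-- The flow starts at the given point. [folklore] -/
@[simp] theorem cutoffFlow_zero (hχ : ContDiff ℝ ∞ χ) (hχc : HasCompactSupport χ) (y : F) : cutoffFlow hχ hχc o y 0 = y :=
  Literature.Analysis.ODE.globalFlow_zero _ _ y

/-- The flow consists of integral curves of the cut-off homothety field. [folklore] -/
theorem hasDerivAt_cutoffFlow (hχ : ContDiff ℝ ∞ χ) (hχc : HasCompactSupport χ) (y : F) (s : ℝ) :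
    HasDerivAt (cutoffFlow hχ hχc o y) (cutoffField χ o (cutoffFlow hχ hχc o y s)) s :=
  Literature.Analysis.ODE.hasDerivAt_globalFlow _ _ y s

/-- **Uniqueness**: an integral curve on an open interval through `0` is the flow curve.
[cite: Lang1995, Ch. IV §1, Thm. 1.3] -/
theorem eqOn_cutoffFlow (hχ : ContDiff ℝ ∞ χ) (hχc : HasCompactSupport χ) {γ : ℝ → F} {a b : ℝ} (h0 : (0 : ℝ) ∈ Ioo a b)
    (hγ : ∀ t ∈ Ioo a b, HasDerivAt γ (cutoffField χ o (γ t)) t) :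
    EqOn γ (cutoffFlow hχ hχc o (γ 0)) (Ioo a b) :=
  Literature.Analysis.ODE.eqOn_globalFlow _ _ h0 hγ

/-- The group law of the flow. [cite: Lang1995, Ch. IV §1, Thm. 1.15] -/
theorem cutoffFlow_add (hχ : ContDiff ℝ ∞ χ) (hχc : HasCompactSupport χ) (y : F) (s t : ℝ) :
    cutoffFlow hχ hχc o y (s + t) = cutoffFlow hχ hχc o (cutoffFlow hχ hχc o y s) t :=
  Literature.Analysis.ODE.globalFlow_add _ _ y s t

/-- The flow is jointly `C^∞`. [cite: Lang1995, Ch. IV §1, Thm. 1.16] -/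
theorem contDiff_cutoffFlow (hχ : ContDiff ℝ ∞ χ) (hχc : HasCompactSupport χ) : ContDiff ℝ ∞ fun p : F × ℝ ↦ cutoffFlow hχ hχc o p.1 p.2 :=
  Literature.Analysis.ODE.contDiff_globalFlow (contDiff_cutoffField hχ) (by simp) _ _

/-- **Fixed points**: where the cut-off vanishes the flow is stationary. [folklore] -/
theorem cutoffFlow_eq_self_of_eq_zero (hχ : ContDiff ℝ ∞ χ) (hχc : HasCompactSupport χ) {y : F} (hy : χ y = 0) (s : ℝ) : cutoffFlow hχ hχc o y s = y :=
  Literature.Analysis.ODE.globalFlow_eq_self_of_eq_zero _ _ (cutoffField_of_eq_zero hy) s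

/-- The centre is fixed. [folklore] -/
theorem cutoffFlow_centre (hχ : ContDiff ℝ ∞ χ) (hχc : HasCompactSupport χ) (s : ℝ) : cutoffFlow hχ hχc o o s = o :=
  Literature.Analysis.ODE.globalFlow_eq_self_of_eq_zero _ _ cutoffField_centre s

/-- **Exact contraction**: if the cut-off is `1` along the ray segment `o + e^{-σ} (y - o)` for
`σ` in an open interval `(a, b) ∋ 0`, then on that interval the flow through `y` is the homothety
`o + e^{-s} (y - o)`. [folklore] -/
theorem cutoffFlow_eq_homothety (hχ : ContDiff ℝ ∞ χ) (hχc : HasCompactSupport χ) {y : F} {a b : ℝ} (h0 : (0 : ℝ) ∈ Ioo a b)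
    (h1 : ∀ σ ∈ Ioo a b, χ (o + Real.exp (-σ) • (y - o)) = 1) {s : ℝ} (hs : s ∈ Ioo a b) :
    cutoffFlow hχ hχc o y s = o + Real.exp (-s) • (y - o) := by
  set γ : ℝ → F := fun σ ↦ o + Real.exp (-σ) • (y - o) with hγ
  have hγd : ∀ σ ∈ Ioo a b, HasDerivAt γ (cutoffField χ o (γ σ)) σ := by
    intro σ hσ
    rw [cutoffField_of_eq_one (h1 σ hσ)]
    have e1 : HasDerivAt (fun σ : ℝ ↦ Real.exp (-σ)) (-Real.exp (-σ)) σ := by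
      simpa using ((hasDerivAt_neg σ).exp)
    have e2 := (e1.smul_const (y - o)).const_add o
    have e3 : -(γ σ - o) = (-Real.exp (-σ)) • (y - o) := by
      simp only [hγ, add_sub_cancel_left, neg_smul]
    rw [e3]
    exact e2
  have h := eqOn_cutoffFlow hχ hχc h0 hγd hs
  have hγ0 : γ 0 = y := by simp [hγ]
  rw [hγ0] at h
  exact h.symm

/-! ### Invariant rays -/

/-- The scalar field of the radial equation along the ray through `y`: `r ↦ -χ(o + r (y - o)) r`.
[folklore] -/
def rayField (χ : F → ℝ) (o y : F) (r : ℝ) : ℝ := -(χ (o + r • (y - o)) * r)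

omit [CompleteSpace F] in
/-- Value of the radial scalar field. [folklore] -/
theorem rayField_apply (χ : F → ℝ) (o y : F) (r : ℝ) : rayField χ o y r = -(χ (o + r • (y - o)) * r) := rfl

omit [CompleteSpace F] in
/-- The radial scalar field is `C^∞`. [folklore] -/
theorem contDiff_rayField (hχ : ContDiff ℝ ∞ χ) (y : F) : ContDiff ℝ ∞ (rayField χ o y) :=
  ((hχ.comp (contDiff_const.add (contDiff_id.smul contDiff_const))).mul contDiff_id).neg

omit [CompleteSpace F] in
/-- Off the centre, the radial scalar field has compact support (the ray meets the support of the
cut-off in a bounded set of parameters). [folklore] -/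
theorem hasCompactSupport_rayField (hχc : HasCompactSupport χ) {y : F} (hy : y ≠ o) : HasCompactSupport (rayField χ o y) := by
  obtain ⟨R, hR⟩ := (hχc.isCompact.isBounded).subset_closedBall 0
  have hyo : 0 < ‖y - o‖ := norm_pos_iff.2 (sub_ne_zero.2 hy)
  set M := (R + ‖o‖) / ‖y - o‖ with hM
  have hsub : support (rayField χ o y) ⊆ Icc (-M) M := by
    intro r hr
    have hχr : χ (o + r • (y - o)) ≠ 0 := by
      intro h; apply hr; simp [rayField, h]
    have hmem : o + r • (y - o) ∈ tsupport χ := subset_tsupport _ hχr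
    have hball := hR hmem
    rw [mem_closedBall, dist_zero_right] at hball
    have h1 : |r| * ‖y - o‖ ≤ R + ‖o‖ := by
      calc |r| * ‖y - o‖ = ‖r • (y - o)‖ := by rw [norm_smul, Real.norm_eq_abs]
        _ = ‖(o + r • (y - o)) - o‖ := by rw [add_sub_cancel_left]
        _ ≤ ‖o + r • (y - o)‖ + ‖o‖ := norm_sub_le _ _
        _ ≤ R + ‖o‖ := by linarith
    have h2 : |r| ≤ M := by rw [hM, le_div_iff₀ hyo]; exact h1
    exact ⟨by linarith [neg_abs_le r], (le_abs_self r).trans h2⟩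
  exact IsCompact.of_isClosed_subset isCompact_Icc (isClosed_tsupport _) (closure_minimal hsub isClosed_Icc)

omit [CompleteSpace F] in
/-- Off the centre, the radial scalar field is Lipschitz and bounded. [folklore] -/
theorem exists_lipschitzWith_rayField (hχ : ContDiff ℝ ∞ χ) (hχc : HasCompactSupport χ) {y : F} (hy : y ≠ o) :
    ∃ KL : ℝ≥0 × ℝ, LipschitzWith KL.1 (rayField χ o y) ∧ ∀ r, ‖rayField χ o y r‖ ≤ KL.2 := by
  obtain ⟨C, hC⟩ := (contDiff_rayField hχ y).lipschitzWith_of_hasCompactSupport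
    (hasCompactSupport_rayField hχc hy) (by simp)
  obtain ⟨B, hB⟩ := (hasCompactSupport_rayField hχc hy).exists_bound_of_continuous
    (contDiff_rayField hχ y).continuous
  exact ⟨(C, B), hC, hB⟩

omit [CompleteSpace F] in
/-- **The ray factor** `r s` of the trajectory through `y ≠ o`: the solution of
`r' = -χ(o + r (y - o)) r`, `r 0 = 1`. [folklore] -/
def rayFactor (hχ : ContDiff ℝ ∞ χ) (hχc : HasCompactSupport χ) {y : F} (hy : y ≠ o) : ℝ → ℝ :=
  Literature.Analysis.ODE.globalFlow (exists_lipschitzWith_rayField hχ hχc hy).choose_spec.1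
    (exists_lipschitzWith_rayField hχ hχc hy).choose_spec.2 1

omit [CompleteSpace F] in
/-- The ray factor starts at `1`. [folklore] -/
@[simp] theorem rayFactor_zero (hχ : ContDiff ℝ ∞ χ) (hχc : HasCompactSupport χ) {y : F} (hy : y ≠ o) : rayFactor hχ hχc hy 0 = 1 :=
  Literature.Analysis.ODE.globalFlow_zero _ _ _

omit [CompleteSpace F] in
/-- The ray factor solves the radial equation. [folklore] -/
theorem hasDerivAt_rayFactor (hχ : ContDiff ℝ ∞ χ) (hχc : HasCompactSupport χ) {y : F} (hy : y ≠ o) (s : ℝ) :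
    HasDerivAt (rayFactor hχ hχc hy) (rayField χ o y (rayFactor hχ hχc hy s)) s :=
  Literature.Analysis.ODE.hasDerivAt_globalFlow _ _ _ s

omit [CompleteSpace F] in
/-- The ray factor is differentiable. [folklore] -/
theorem differentiable_rayFactor (hχ : ContDiff ℝ ∞ χ) (hχc : HasCompactSupport χ) {y : F} (hy : y ≠ o) : Differentiable ℝ (rayFactor hχ hχc hy) :=
  fun s ↦ (hasDerivAt_rayFactor hχ hχc hy s).differentiableAt

omit [CompleteSpace F] in
/-- The ray factor is continuous. [folklore] -/
theorem continuous_rayFactor (hχ : ContDiff ℝ ∞ χ) (hχc : HasCompactSupport χ) {y : F} (hy : y ≠ o) : Continuous (rayFactor hχ hχc hy) :=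
  (differentiable_rayFactor hχ hχc hy).continuous

omit [CompleteSpace F] in
/-- The derivative of the ray factor. [folklore] -/
theorem deriv_rayFactor (hχ : ContDiff ℝ ∞ χ) (hχc : HasCompactSupport χ) {y : F} (hy : y ≠ o) (s : ℝ) :
    deriv (rayFactor hχ hχc hy) s =
      -(χ (o + rayFactor hχ hχc hy s • (y - o)) * rayFactor hχ hχc hy s) :=
  (hasDerivAt_rayFactor hχ hχc hy s).deriv

/-- **Invariant rays**: the trajectory through `y ≠ o` stays on the ray from `o` through `y`,
`cutoffFlow y s = o + r s • (y - o)` with the ray factor `r`. [folklore] -/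
theorem cutoffFlow_eq_ray (hχ : ContDiff ℝ ∞ χ) (hχc : HasCompactSupport χ) {y : F} (hy : y ≠ o) (s : ℝ) :
    cutoffFlow hχ hχc o y s = o + rayFactor hχ hχc hy s • (y - o) := by
  set γ : ℝ → F := fun σ ↦ o + rayFactor hχ hχc hy σ • (y - o) with hγ
  have hγd : ∀ σ ∈ Ioo (-(|s| + 1)) (|s| + 1), HasDerivAt γ (cutoffField χ o (γ σ)) σ := by
    intro σ _
    have h1 := ((hasDerivAt_rayFactor hχ hχc hy σ).smul_const (y - o)).const_add o
    have e : rayField χ o y (rayFactor hχ hχc hy σ) • (y - o) = cutoffField χ o (γ σ) := by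
      simp only [rayField, cutoffField_apply, hγ, add_sub_cancel_left, neg_smul, smul_smul]
    rw [← e]
    exact h1
  have h0 : (0 : ℝ) ∈ Ioo (-(|s| + 1)) (|s| + 1) := ⟨by linarith [abs_nonneg s], by linarith [abs_nonneg s]⟩
  have hs : s ∈ Ioo (-(|s| + 1)) (|s| + 1) := by constructor <;> cases abs_cases s <;> linarith
  have h := eqOn_cutoffFlow hχ hχc h0 hγd hs
  have hγ0 : γ 0 = y := by simp [hγ]
  rw [hγ0] at h
  exact h.symm

omit [CompleteSpace F] in
/-- The ray factor never vanishes (the zero solution is an equilibrium of the radial equation).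
[folklore] -/
theorem rayFactor_ne_zero (hχ : ContDiff ℝ ∞ χ) (hχc : HasCompactSupport χ) {y : F} (hy : y ≠ o) (s : ℝ) : rayFactor hχ hχc hy s ≠ 0 := by
  intro h0
  have hK := (exists_lipschitzWith_rayField hχ hχc hy).choose_spec.1
  have hL := (exists_lipschitzWith_rayField hχ hχc hy).choose_spec.2
  have hzero : ∀ t, Literature.Analysis.ODE.globalFlow hK hL 0 t = 0 := fun t ↦
    Literature.Analysis.ODE.globalFlow_eq_self_of_eq_zero hK hL (by simp [rayField]) t
  have h1 : rayFactor hχ hχc hy (s + -s) = Literature.Analysis.ODE.globalFlow hK hL (rayFactor hχ hχc hy s) (-s) :=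
    Literature.Analysis.ODE.globalFlow_add hK hL 1 s (-s)
  rw [add_neg_cancel, rayFactor_zero, h0, hzero] at h1
  exact one_ne_zero h1

omit [CompleteSpace F] in
/-- The ray factor is positive. [folklore] -/
theorem rayFactor_pos (hχ : ContDiff ℝ ∞ χ) (hχc : HasCompactSupport χ) {y : F} (hy : y ≠ o) (s : ℝ) : 0 < rayFactor hχ hχc hy s := by
  by_contra h
  push Not at h
  -- intermediate value between `r s ≤ 0` and `r 0 = 1`
  have hcont := continuous_rayFactor hχ hχc hy
  rcases le_total s 0 with hs0 | hs0
  · have hivt := intermediate_value_Icc hs0 hcont.continuousOn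
    have : (0 : ℝ) ∈ Icc (rayFactor hχ hχc hy s) (rayFactor hχ hχc hy 0) := ⟨h, by simp⟩
    obtain ⟨t, -, ht⟩ := hivt this
    exact rayFactor_ne_zero hχ hχc hy t ht
  · have hivt := intermediate_value_Icc' hs0 hcont.continuousOn
    have : (0 : ℝ) ∈ Icc (rayFactor hχ hχc hy s) (rayFactor hχ hχc hy 0) := ⟨h, by simp⟩
    obtain ⟨t, -, ht⟩ := hivt this
    exact rayFactor_ne_zero hχ hχc hy t ht

omit [CompleteSpace F] in
/-- **Towards the centre**: for a nonnegative cut-off the ray factor is at most `1` in forward time.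
[folklore] -/
theorem rayFactor_le_one (hχ : ContDiff ℝ ∞ χ) (hχc : HasCompactSupport χ) (hχ0 : ∀ z, 0 ≤ χ z) {y : F} (hy : y ≠ o) {s : ℝ} (hs : 0 ≤ s) :
    rayFactor hχ hχc hy s ≤ 1 := by
  have hanti : Antitone (rayFactor hχ hχc hy) := by
    refine antitone_of_deriv_nonpos (differentiable_rayFactor hχ hχc hy) fun t ↦ ?_
    rw [deriv_rayFactor]
    have := mul_nonneg (hχ0 (o + rayFactor hχ hχc hy t • (y - o))) (rayFactor_pos hχ hχc hy t).le
    linarith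
  simpa using hanti hs

omit [CompleteSpace F] in
/-- **At most unit exponential rate**: for a cut-off `≤ 1` the ray factor is at least `e^{-s}` in
forward time (`(r e^s)' = e^s r (1 - χ) ≥ 0`). [folklore] -/
theorem exp_neg_le_rayFactor (hχ : ContDiff ℝ ∞ χ) (hχc : HasCompactSupport χ) (hχ1 : ∀ z, χ z ≤ 1) {y : F} (hy : y ≠ o) {s : ℝ} (hs : 0 ≤ s) :
    Real.exp (-s) ≤ rayFactor hχ hχc hy s := by
  set q : ℝ → ℝ := fun t ↦ rayFactor hχ hχc hy t * Real.exp t with hq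
  have hqd : ∀ t, HasDerivAt q (Real.exp t * rayFactor hχ hχc hy t *
      (1 - χ (o + rayFactor hχ hχc hy t • (y - o)))) t := by
    intro t
    have h1 := (hasDerivAt_rayFactor hχ hχc hy t).mul (Real.hasDerivAt_exp t)
    have e : rayField χ o y (rayFactor hχ hχc hy t) * Real.exp t + rayFactor hχ hχc hy t * Real.exp t =
        Real.exp t * rayFactor hχ hχc hy t * (1 - χ (o + rayFactor hχ hχc hy t • (y - o))) := by
      rw [rayField_apply]; ring
    rw [← e]
    exact h1
  have hmono : Monotone q := by
    refine monotone_of_deriv_nonneg (fun t ↦ (hqd t).differentiableAt) fun t ↦ ?_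
    rw [(hqd t).deriv]
    exact mul_nonneg (mul_nonneg (Real.exp_pos t).le (rayFactor_pos hχ hχc hy t).le)
      (by linarith [hχ1 (o + rayFactor hχ hχc hy t • (y - o))])
  have h := hmono hs
  have h' : 1 ≤ rayFactor hχ hχc hy s * Real.exp s := by
    have e0 : q 0 = 1 := by simp [hq]
    rw [← e0]; exact h
  have hexp := Real.exp_pos s
  rw [Real.exp_neg, inv_le_iff_one_le_mul₀ hexp]
  linarith

/-- **Forward-time position on the ray**: for a cut-off with values in `[0, 1]`, at time `s ≥ 0`
the trajectory through `y` is `o + ρ (y - o)` with `e^{-s} ≤ ρ ≤ 1`. [folklore] -/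
theorem cutoffFlow_mem_ray (hχ : ContDiff ℝ ∞ χ) (hχc : HasCompactSupport χ) (hχ0 : ∀ z, 0 ≤ χ z) (hχ1 : ∀ z, χ z ≤ 1) (y : F) {s : ℝ} (hs : 0 ≤ s) :
    ∃ ρ ∈ Icc (Real.exp (-s)) 1, cutoffFlow hχ hχc o y s = o + ρ • (y - o) := by
  by_cases hy : y = o
  · subst hy
    exact ⟨1, ⟨(Real.exp_le_one_iff (x := -s)).2 (by linarith), le_rfl⟩, by simp [cutoffFlow_centre hχ hχc]⟩
  · exact ⟨rayFactor hχ hχc hy s, ⟨exp_neg_le_rayFactor hχ hχc hχ1 hy hs, rayFactor_le_one hχ hχc hχ0 hy hs⟩,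
      cutoffFlow_eq_ray hχ hχc hy s⟩

end Field

/-! ## Transport to a closed manifold along a full chart -/

section Chart

variable {E : Type*} [NormedAddCommGroup E] [NormedSpace ℝ E] [FiniteDimensional ℝ E]
  {N : Type*} [TopologicalSpace N] [ChartedSpace E N] [IsManifold 𝓘(ℝ, E) ∞ N]
  [T2Space N] [CompactSpace N] [BoundarylessManifold 𝓘(ℝ, E) N]
  {Φ : OpenPartialHomeomorph N E} {χ : E → ℝ} {o : E}

namespace IsFullChart

variable (h : IsFullChart Φ)
include h

omit [CompactSpace N] [BoundarylessManifold 𝓘(ℝ, E) N] in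
/-- The push-forward of the cut-off homothety field along the inverse chart is a smooth vector
field on `N`. [cite: LeeSmoothManifolds2013, Prop. 8.19] -/
theorem contMDiff_chartField_cutoff (hχ : ContDiff ℝ ∞ χ) (hχc : HasCompactSupport χ) :
    ContMDiff 𝓘(ℝ, E) 𝓘(ℝ, E).tangent ∞
      fun x => (⟨x, chartField Φ (cutoffField χ o) x⟩ : TangentBundle 𝓘(ℝ, E) N) :=
  h.contMDiff_chartField (contDiff_cutoffField hχ) (hasCompactSupport_cutoffField hχc)

/-- **The flow on `N` follows the flow in the chart**: the flow of the pushed-forward cut-off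
homothety field carries `Φ⁻¹ y` to `Φ⁻¹ (cutoffFlow y s)`. [cite: LeeSmoothManifolds2013, Prop. 9.6 and Thm. 9.12 (a)] -/
theorem flow_chartField_cutoff (hχ : ContDiff ℝ ∞ χ) (hχc : HasCompactSupport χ) (y : E) (s : ℝ) :
    flow (h.contMDiff_chartField_cutoff hχ hχc (o := o)) (Φ.symm y) s = Φ.symm (cutoffFlow hχ hχc o y s) := by
  haveI : CompleteSpace E := FiniteDimensional.complete ℝ E
  have h0 : (0 : ℝ) ∈ Ioo (-(|s| + 1)) (|s| + 1) := ⟨by linarith [abs_nonneg s], by linarith [abs_nonneg s]⟩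
  have hs : s ∈ Ioo (-(|s| + 1)) (|s| + 1) := by constructor <;> cases abs_cases s <;> linarith
  have key := h.flow_chartField_symm (contDiff_cutoffField hχ) (hasCompactSupport_cutoffField hχc)
    (γ := cutoffFlow hχ hχc o y) h0 (fun σ _ ↦ hasDerivAt_cutoffFlow hχ hχc y σ) hs
  simpa using key

/-- Points off the chart do not move. [folklore] -/
theorem flow_chartField_cutoff_eq_self_of_not_mem (hχ : ContDiff ℝ ∞ χ) (hχc : HasCompactSupport χ) {x : N} (hx : x ∉ Φ.source) (s : ℝ) :
    flow (h.contMDiff_chartField_cutoff hχ hχc (o := o)) x s = x :=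
  h.flow_chartField_eq_self_of_not_mem_source (contDiff_cutoffField hχ) (hasCompactSupport_cutoffField hχc) hx s

/-- **The cut-off contraction of `N`**: the ambient isotopy generated by the pushed-forward cut-off
homothety field, run up to time `T` (`flowIsotopyAt`; Hirsch (1976), Ch. 8 §1, Thm. 1.2).
[cite: HirschDT1976, Ch. 8 §1, Thm. 1.2] -/
def cutoffContraction (h : IsFullChart Φ) (hχ : ContDiff ℝ ∞ χ) (hχc : HasCompactSupport χ) (o : E)
    (T : ℝ) : AmbientIsotopy 𝓘(ℝ, E) N :=
  flowIsotopyAt (h.contMDiff_chartField_cutoff hχ hχc (o := o)) T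

/-- The stages of the cut-off contraction on the chart: `Φ⁻¹ y ↦ Φ⁻¹ (cutoffFlow y (s T))`.
[folklore] -/
theorem cutoffContraction_toFun_symm (hχ : ContDiff ℝ ∞ χ) (hχc : HasCompactSupport χ) (T s : ℝ) (y : E) :
    (h.cutoffContraction hχ hχc o T).toFun s (Φ.symm y) = Φ.symm (cutoffFlow hχ hχc o y (s * T)) := by
  rw [cutoffContraction, flowIsotopyAt_toFun, h.flow_chartField_cutoff]

/-- The end stage of the cut-off contraction on the chart: `Φ⁻¹ y ↦ Φ⁻¹ (cutoffFlow y T)`.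
[folklore] -/
theorem cutoffContraction_one_symm (hχ : ContDiff ℝ ∞ χ) (hχc : HasCompactSupport χ) (T : ℝ) (y : E) :
    (h.cutoffContraction hχ hχc o T).toFun 1 (Φ.symm y) = Φ.symm (cutoffFlow hχ hχc o y T) := by
  rw [h.cutoffContraction_toFun_symm, one_mul]

/-- The stages of the cut-off contraction fix the points off the chart. [folklore] -/
theorem cutoffContraction_toFun_of_not_mem (hχ : ContDiff ℝ ∞ χ) (hχc : HasCompactSupport χ) (T s : ℝ) {x : N} (hx : x ∉ Φ.source) :
    (h.cutoffContraction hχ hχc o T).toFun s x = x := by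
  rw [cutoffContraction, flowIsotopyAt_toFun]
  exact h.flow_chartField_cutoff_eq_self_of_not_mem hχ hχc hx _

/-- **Fixed points**: the stages fix `Φ⁻¹ y` where the cut-off vanishes. [folklore] -/
theorem cutoffContraction_toFun_symm_of_eq_zero (hχ : ContDiff ℝ ∞ χ) (hχc : HasCompactSupport χ) (T s : ℝ) {y : E} (hy : χ y = 0) :
    (h.cutoffContraction hχ hχc o T).toFun s (Φ.symm y) = Φ.symm y := by
  haveI : CompleteSpace E := FiniteDimensional.complete ℝ E
  rw [h.cutoffContraction_toFun_symm, cutoffFlow_eq_self_of_eq_zero hχ hχc hy]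

/-- **Exact contraction**: if the cut-off is `1` along the ray segment `o + ρ (y - o)` for all `ρ`
in an open interval containing `[e^{-T}, 1]`, the end stage maps `Φ⁻¹ y` to
`Φ⁻¹ (o + e^{-T} (y - o))`. [folklore] -/
theorem cutoffContraction_one_symm_eq_homothety (hχ : ContDiff ℝ ∞ χ) (hχc : HasCompactSupport χ) {T : ℝ} (hT : 0 ≤ T) {y : E} {a b : ℝ}
    (hab : Icc 0 T ⊆ Ioo a b) (h1 : ∀ σ ∈ Ioo a b, χ (o + Real.exp (-σ) • (y - o)) = 1) :
    (h.cutoffContraction hχ hχc o T).toFun 1 (Φ.symm y) = Φ.symm (o + Real.exp (-T) • (y - o)) := by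
  haveI : CompleteSpace E := FiniteDimensional.complete ℝ E
  rw [h.cutoffContraction_one_symm, cutoffFlow_eq_homothety hχ hχc (hab ⟨le_rfl, hT⟩) h1 (hab ⟨hT, le_rfl⟩)]

/-- **Invariant rays**: for a cut-off with values in `[0, 1]` and `T ≥ 0`, the end stage maps
`Φ⁻¹ y` to `Φ⁻¹ (o + ρ (y - o))` for some `ρ ∈ [e^{-T}, 1]`. [folklore] -/
theorem cutoffContraction_one_symm_mem_ray (hχ : ContDiff ℝ ∞ χ) (hχc : HasCompactSupport χ) (hχ0 : ∀ z, 0 ≤ χ z) (hχ1 : ∀ z, χ z ≤ 1) {T : ℝ}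
    (hT : 0 ≤ T) (y : E) :
    ∃ ρ ∈ Icc (Real.exp (-T)) 1,
      (h.cutoffContraction hχ hχc o T).toFun 1 (Φ.symm y) = Φ.symm (o + ρ • (y - o)) := by
  haveI : CompleteSpace E := FiniteDimensional.complete ℝ E
  obtain ⟨ρ, hρ, he⟩ := cutoffFlow_mem_ray hχ hχc hχ0 hχ1 y hT
  exact ⟨ρ, hρ, by rw [h.cutoffContraction_one_symm, he]⟩

/-- **The cut-off contraction is an ambient isotopy from the identity**: any map `f` into `N` is
ambient isotopic to its composite with the end stage. [cite: HirschDT1976, Ch. 8 §1, Thm. 1.2] -/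
theorem isAmbientIsotopic_cutoffContraction (hχ : ContDiff ℝ ∞ χ) (hχc : HasCompactSupport χ) {X : Type*} {EM HM : Type*} [NormedAddCommGroup EM]
    [NormedSpace ℝ EM] [TopologicalSpace HM] (I : ModelWithCorners ℝ EM HM) (f : X → N) (T : ℝ) :
    IsAmbientIsotopic I 𝓘(ℝ, E) f ((h.cutoffContraction hχ hχc o T).toFun 1 ∘ f) :=
  ⟨h.cutoffContraction hχ hχc o T, rfl⟩

end IsFullChart

end Chart

end Literature.Topology.FourManifolds
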